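import Summits.CriticalPhenomena.PercolationContinuityZ3.Theorems.PercNearOneGluingNoHeavyQuantIndepBlobMoments
import HarnessLib

/-!
# QUANT lane R8, FAR on general trees — the GAP CALCULUS for independent blobs (I): heavy blobs ADD their size to the
# gap parameter (a Hall-free proof of the size/gap rows) and the splitting certificate `GAP(S, 2j+1 − A'') ⟹ tail ≥ x`

builds on p205010 (kernel theorem, internal audit signed; external expert review pending)

Support file (`--supports stmt-CriticalPhenomena-4575`), QUANT lane lead (gen 16), rung R8 of
`run/shared/lean/prim/quant/LADDER.md`; memo `run/shared/lean/prim/quant/prim-quant-lead-g16/LEAD-NOTES-G16.md` N30.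
Theorems only, no definitions, no sorries, standard axioms.  Part (II) (`…QuantIndepBlobGapCompanion`) derives the COMPANION
certificate for the open corner of Conjecture DIB\* (`…QuantDIBStar`: floor `> 1/2`, heavy total `≤ 2j`, light blobs present).

SETTING.  Blobs `k : κ` with sizes `a k ∈ ℕ` and gates `p k ∈ [0,1]`; for a finset `U` of blobs the RESTRICTED law is the
product-Bernoulli law of the blobs of `U` only, weight `∏_{k ∈ U} (if k ∈ s then p k else 1 − p k)` on `s ⊆ U`, with restricted
tail `TL_U(t) = Σ_{s ⊆ U} weight · 𝟙[t ≤ Σ_{k ∈ s} a k] = P(N_U ≥ t)` (`TL_U(0) = 1`; `TL_univ` is the tail of the usual law on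
`Finset κ`).  For a floor `x` and an integer `E`, `U` has the GAP PROPERTY AT `E` if for all levels `y ≤ v` with `y + v ≤ E + 1`
`x ≤ x·TL_U(y) + (1 − x)·TL_U(v)` — i.e. `x·P(N_U ≤ u) ≤ (1 − x)·P(N_U ≥ v)` for all `u < v`, `u + v ≤ E`, the two-threshold rows
of `IndepBlob.gapRow_of_half_le_gate` (`…QuantIndepBlobGapRow`) in tail form.  The pair `y = v = j+1` of the gap property at `2j+1`
is the row `x ≤ P(N ≥ j+1)`.

* `Quant.IndepBlob.sum_powerset_weight_insert`, `tailU_insert` — conditioning on one blob: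
  `TL_{U+k}(t) = p k·TL_U(t − a k) + (1 − p k)·TL_U(t)`; `sum_powerset_weight`, `tailU_zero`, `tailU_nonneg`, `tailU_le_one`,
  `tailU_antitone`, `tailU_univ` (bridge to the usual tail on `Finset κ`).
* `Quant.IndepBlob.gap_insert` — **THE ONE-BLOB EXTENSION LEMMA**: if `U` has the gap property at `E`, `1/2 ≤ x` and `k ∉ U` is
  HEAVY (`x ≤ p k ≤ 1`), then `U + k` has the gap property at `E + a k`.  The claim is affine in `p k ∈ [x, 1]`; at `p k = 1` it is
  the pair `(y − a, v − a)` of `U`, at `p k = x` it is `x·`pair`(y − a, v)` `+ (1 − x)·`pair`(min(y, v − a), max(y, v − a))` plus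
  `(1 − x)(2x − 1)(TL_U(max) − TL_U(v)) ≥ 0`.  No Hall theorem, no antipodal Harris inequality (contrast `…QuantIndepBlobFar`).
* `Quant.IndepBlob.gap_union` — a finset `H` of heavy blobs adds `Σ_H a` to the gap parameter; with `S = ∅`,
  `tail_ge_of_heavy_sizes`: gates `∈ [x,1]`, `1/2 ≤ x ≤ 1`, `2j+1 ≤ Σ a ⟹ x ≤ P(N ≥ j+1)` (the odd size row with the floor as a
  PARAMETER; cf. `tail_ge_gate_of_two_mul_le_size_succ`, `…QuantIndepBlobOddSizeRow`, whose floor is an attained gate).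
* `Quant.IndepBlob.tail_ge_of_gapCert` — **THE SPLITTING CERTIFICATE**: if the blobs OFF a finset `S` are heavy and `S` alone has
  the gap property at `2j + 1 − Σ_{k ∉ S} a k`, then `x ≤ P(N ≥ j+1)` for the whole system.  A term of the root decomposition
  (`Quant.RootDec.rtail_ge_of_decCert`, `…QuantDIBStar`) is thus certified by a FINITE check on its non-heavy part.

Numerics (lead g16, `prim-quant-lead-g16/explore/check_lemmas.py`, `gapcert*.py`): the one-blob lemma with ARBITRARY base systems
3 000/0; in DIB\*'s corner (`x ∈ (1/2, 1)`, credit `> 2j`, heavy total `≤ 2j`) SOME finset `S ⊇ lights` certifies every one of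
63 369 sampled exact instances via `tail_ge_of_gapCert` (a single heavy companion in 99.5 % of them); the gap parameter is
numerically SUPERADDITIVE over independent unions for arbitrary gates (4 000/0, LEAD-NOTES-G16 N30 (4)).  Nearest prior art searched
(corpus fts + vec, galaxy `reflection|dominance|odds`): at `x = 1/2` the gap property is stochastic dominance of `N` over `E − N`,
closed under convolution classically; the `x > 1/2` calculus is [this work].  The gluing rows served: [cite: KozmaNitzan2024, Conjecture 3 (p. 15)].
-/

namespace Summit.CriticalPhenomena.PercolationContinuityZ3.Theorems

namespace Quant

namespace IndepBlob

open Finset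

variable {κ : Type*} [DecidableEq κ]

/-! ### 1. The restricted law: conditioning on one blob, total mass, tails -/

/-- The restricted weight is nonnegative. [this work] -/
theorem weightU_nonneg (p : κ → ℝ) (U : Finset κ) (hp0 : ∀ k ∈ U, 0 ≤ p k) (hp1 : ∀ k ∈ U, p k ≤ 1) (s : Finset κ) :
    0 ≤ ∏ k ∈ U, (if k ∈ s then p k else 1 - p k) := by
  refine Finset.prod_nonneg fun k hk => ?_
  split_ifs
  · exact hp0 k hk
  · linarith [hp1 k hk]

/-- **Conditioning on one blob** (generic form): for `k ∉ U` and any `f`,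
`Σ_{s ⊆ U+k} w_{U+k}(s) f(s) = p k·Σ_{s ⊆ U} w_U(s) f(s+k) + (1 − p k)·Σ_{s ⊆ U} w_U(s) f(s)`. [this work] -/
theorem sum_powerset_weight_insert (p : κ → ℝ) (U : Finset κ) (k : κ) (hk : k ∉ U) (f : Finset κ → ℝ) :
    ∑ s ∈ (insert k U).powerset, (∏ i ∈ insert k U, (if i ∈ s then p i else 1 - p i)) * f s =
      p k * ∑ s ∈ U.powerset, (∏ i ∈ U, (if i ∈ s then p i else 1 - p i)) * f (insert k s) +
      (1 - p k) * ∑ s ∈ U.powerset, (∏ i ∈ U, (if i ∈ s then p i else 1 - p i)) * f s := by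
  rw [Finset.sum_powerset_insert hk, add_comm, Finset.mul_sum, Finset.mul_sum]
  congr 1
  · refine Finset.sum_congr rfl fun s hs => ?_
    have hsU : s ⊆ U := Finset.mem_powerset.mp hs
    have hks : k ∉ s := fun h => hk (hsU h)
    rw [Finset.prod_insert hk]
    have h1 : (if k ∈ insert k s then p k else 1 - p k) = p k := by simp
    rw [h1]
    have h2 : ∏ i ∈ U, (if i ∈ insert k s then p i else 1 - p i) = ∏ i ∈ U, (if i ∈ s then p i else 1 - p i) := by
      refine Finset.prod_congr rfl fun i hi => ?_
      have hik : i ≠ k := fun h => hk (h ▸ hi)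
      simp [Finset.mem_insert, hik]
    rw [h2]; ring
  · refine Finset.sum_congr rfl fun s hs => ?_
    have hsU : s ⊆ U := Finset.mem_powerset.mp hs
    have hks : k ∉ s := fun h => hk (hsU h)
    rw [Finset.prod_insert hk]
    have h1 : (if k ∈ s then p k else 1 - p k) = 1 - p k := by simp [hks]
    rw [h1]; ring

/-- Total mass one of the restricted law: `Σ_{s ⊆ U} w_U(s) = 1`. [this work] -/
theorem sum_powerset_weight (p : κ → ℝ) (U : Finset κ) :
    ∑ s ∈ U.powerset, (∏ i ∈ U, (if i ∈ s then p i else 1 - p i)) = 1 := by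
  induction U using Finset.induction_on with
  | empty => simp
  | @insert k U hk ih =>
    have h := sum_powerset_weight_insert p U k hk (fun _ => (1 : ℝ))
    simp only [mul_one] at h
    rw [h, ih]; ring

/-- **Conditioning the restricted tail on one blob**: for `k ∉ U`,
`TL_{U+k}(t) = p k·TL_U(t − a k) + (1 − p k)·TL_U(t)` (truncated subtraction: `TL_U(0) = 1`). [this work] -/
theorem tailU_insert (p : κ → ℝ) (a : κ → ℕ) (U : Finset κ) (k : κ) (hk : k ∉ U) (t : ℕ) :
    ∑ s ∈ (insert k U).powerset, (∏ i ∈ insert k U, (if i ∈ s then p i else 1 - p i)) *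
        (if t ≤ ∑ i ∈ s, a i then (1 : ℝ) else 0) =
      p k * ∑ s ∈ U.powerset, (∏ i ∈ U, (if i ∈ s then p i else 1 - p i)) *
          (if t - a k ≤ ∑ i ∈ s, a i then (1 : ℝ) else 0) +
      (1 - p k) * ∑ s ∈ U.powerset, (∏ i ∈ U, (if i ∈ s then p i else 1 - p i)) *
          (if t ≤ ∑ i ∈ s, a i then (1 : ℝ) else 0) := by
  rw [sum_powerset_weight_insert p U k hk]
  congr 2
  refine Finset.sum_congr rfl fun s hs => ?_
  have hsU : s ⊆ U := Finset.mem_powerset.mp hs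
  have hks : k ∉ s := fun h => hk (hsU h)
  rw [Finset.sum_insert hks]
  simp only [tsub_le_iff_left]

/-- `TL_U(0) = 1`. [this work] -/
theorem tailU_zero (p : κ → ℝ) (a : κ → ℕ) (U : Finset κ) :
    ∑ s ∈ U.powerset, (∏ i ∈ U, (if i ∈ s then p i else 1 - p i)) *
        (if (0 : ℕ) ≤ ∑ i ∈ s, a i then (1 : ℝ) else 0) = 1 := by
  have h : ∀ s ∈ U.powerset, (∏ i ∈ U, (if i ∈ s then p i else 1 - p i)) *
      (if (0 : ℕ) ≤ ∑ i ∈ s, a i then (1 : ℝ) else 0) = ∏ i ∈ U, (if i ∈ s then p i else 1 - p i) := by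
    intro s _; simp
  rw [Finset.sum_congr rfl h, sum_powerset_weight]

/-- `0 ≤ TL_U(t)`. [this work] -/
theorem tailU_nonneg (p : κ → ℝ) (a : κ → ℕ) (U : Finset κ) (hp0 : ∀ k ∈ U, 0 ≤ p k) (hp1 : ∀ k ∈ U, p k ≤ 1) (t : ℕ) :
    0 ≤ ∑ s ∈ U.powerset, (∏ i ∈ U, (if i ∈ s then p i else 1 - p i)) *
        (if t ≤ ∑ i ∈ s, a i then (1 : ℝ) else 0) := by
  refine Finset.sum_nonneg fun s _ => mul_nonneg (weightU_nonneg p U hp0 hp1 s) ?_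
  split_ifs <;> norm_num

/-- `TL_U(t) ≤ 1`. [this work] -/
theorem tailU_le_one (p : κ → ℝ) (a : κ → ℕ) (U : Finset κ) (hp0 : ∀ k ∈ U, 0 ≤ p k) (hp1 : ∀ k ∈ U, p k ≤ 1) (t : ℕ) :
    ∑ s ∈ U.powerset, (∏ i ∈ U, (if i ∈ s then p i else 1 - p i)) *
        (if t ≤ ∑ i ∈ s, a i then (1 : ℝ) else 0) ≤ 1 := by
  calc ∑ s ∈ U.powerset, (∏ i ∈ U, (if i ∈ s then p i else 1 - p i)) *
        (if t ≤ ∑ i ∈ s, a i then (1 : ℝ) else 0)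
      ≤ ∑ s ∈ U.powerset, (∏ i ∈ U, (if i ∈ s then p i else 1 - p i)) := by
        refine Finset.sum_le_sum fun s _ => ?_
        have hw := weightU_nonneg p U hp0 hp1 s
        split_ifs <;> nlinarith
    _ = 1 := sum_powerset_weight p U

/-- `TL_U` is antitone in the level: `t ≤ t' ⟹ TL_U(t') ≤ TL_U(t)`. [this work] -/
theorem tailU_antitone (p : κ → ℝ) (a : κ → ℕ) (U : Finset κ) (hp0 : ∀ k ∈ U, 0 ≤ p k) (hp1 : ∀ k ∈ U, p k ≤ 1)
    {t t' : ℕ} (htt : t ≤ t') :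
    ∑ s ∈ U.powerset, (∏ i ∈ U, (if i ∈ s then p i else 1 - p i)) *
        (if t' ≤ ∑ i ∈ s, a i then (1 : ℝ) else 0) ≤
      ∑ s ∈ U.powerset, (∏ i ∈ U, (if i ∈ s then p i else 1 - p i)) *
        (if t ≤ ∑ i ∈ s, a i then (1 : ℝ) else 0) := by
  refine Finset.sum_le_sum fun s _ => mul_le_mul_of_nonneg_left ?_ (weightU_nonneg p U hp0 hp1 s)
  by_cases h : t' ≤ ∑ i ∈ s, a i
  · have h' : t ≤ ∑ i ∈ s, a i := le_trans htt h
    simp [h, h']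
  · simp only [h, if_false]
    split_ifs <;> norm_num

/-- **Bridge**: the restricted tail at `U = univ` is the usual tail of the product-Bernoulli law on `Finset κ`. [this work] -/
theorem tailU_univ [Fintype κ] (p : κ → ℝ) (a : κ → ℕ) (t : ℕ) :
    ∑ s ∈ (Finset.univ : Finset κ).powerset, (∏ i ∈ (Finset.univ : Finset κ), (if i ∈ s then p i else 1 - p i)) *
        (if t ≤ ∑ i ∈ s, a i then (1 : ℝ) else 0) =
      ∑ s : Finset κ, (∏ i, (if i ∈ s then p i else 1 - p i)) * (if t ≤ ∑ i ∈ s, a i then (1 : ℝ) else 0) := by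
  rw [Finset.powerset_univ]

/-! ### 2. The one-blob extension lemma and the gap calculus -/

/-- **THE ONE-BLOB EXTENSION LEMMA.**  If `U` has the gap property at `E` (floor `x ∈ [1/2, 1]`: for all levels `y ≤ v` with
`y + v ≤ E + 1`, `x ≤ x·TL_U(y) + (1 − x)·TL_U(v)`) and `k ∉ U` is a heavy blob (`x ≤ p k ≤ 1`), then `U + k` has the gap
property at `E + a k`.  The claim is affine in `p k`; at `p k = 1` it is a pair of `U`, at `p k = x` it is an `(x, 1−x)`-combination
of two pairs of `U` plus `(1 − x)(2x − 1)·(TL_U(max(y, v − a)) − TL_U(v)) ≥ 0`. [this work] -/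
theorem gap_insert (p : κ → ℝ) (a : κ → ℕ) (x : ℝ) (hx : 1 / 2 ≤ x) (U : Finset κ)
    (hp0 : ∀ i ∈ U, 0 ≤ p i) (hp1 : ∀ i ∈ U, p i ≤ 1) (k : κ) (hk : k ∉ U) (hkx : x ≤ p k) (hk1 : p k ≤ 1) (E : ℕ)
    (hU : ∀ y v : ℕ, y ≤ v → y + v ≤ E + 1 →
      x ≤ x * (∑ s ∈ U.powerset, (∏ i ∈ U, (if i ∈ s then p i else 1 - p i)) *
              (if y ≤ ∑ i ∈ s, a i then (1 : ℝ) else 0)) +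
          (1 - x) * (∑ s ∈ U.powerset, (∏ i ∈ U, (if i ∈ s then p i else 1 - p i)) *
              (if v ≤ ∑ i ∈ s, a i then (1 : ℝ) else 0))) :
    ∀ y v : ℕ, y ≤ v → y + v ≤ E + a k + 1 →
      x ≤ x * (∑ s ∈ (insert k U).powerset, (∏ i ∈ insert k U, (if i ∈ s then p i else 1 - p i)) *
              (if y ≤ ∑ i ∈ s, a i then (1 : ℝ) else 0)) +
          (1 - x) * (∑ s ∈ (insert k U).powerset, (∏ i ∈ insert k U, (if i ∈ s then p i else 1 - p i)) *
              (if v ≤ ∑ i ∈ s, a i then (1 : ℝ) else 0)) := by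
  intro y v hyv hsum
  rw [tailU_insert p a U k hk y, tailU_insert p a U k hk v]
  -- abbreviations for the restricted tail of `U`
  set T : ℕ → ℝ := fun t => ∑ s ∈ U.powerset, (∏ i ∈ U, (if i ∈ s then p i else 1 - p i)) *
      (if t ≤ ∑ i ∈ s, a i then (1 : ℝ) else 0) with hT
  have hT0 : T 0 = 1 := by simp only [hT]; exact tailU_zero p a U
  have hTnn : ∀ t, 0 ≤ T t := fun t => by simp only [hT]; exact tailU_nonneg p a U hp0 hp1 t
  have hTanti : ∀ {t t' : ℕ}, t ≤ t' → T t' ≤ T t := fun htt => by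
    simp only [hT]; exact tailU_antitone p a U hp0 hp1 htt
  have hU' : ∀ y v : ℕ, y ≤ v → y + v ≤ E + 1 → x ≤ x * T y + (1 - x) * T v := fun y v h1 h2 => by
    simp only [hT]; exact hU y v h1 h2
  set q := p k with hq
  set b := a k with hb
  have hx0 : 0 ≤ x := by linarith
  have h1x : 0 ≤ 1 - x := by linarith
  change x ≤ x * (q * T (y - b) + (1 - q) * T y) + (1 - x) * (q * T (v - b) + (1 - q) * T v)
  -- (P1) the pair `(y − b, v)` of `U`
  have P1 : x ≤ x * T (y - b) + (1 - x) * T v := by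
    by_cases hby : b ≤ y
    · exact hU' (y - b) v (by omega) (by omega)
    · have h0 : y - b = 0 := by omega
      rw [h0, hT0]
      nlinarith [hTnn v]
  -- (P3) the pair `(y − b, v − b)` of `U`
  have P3 : x ≤ x * T (y - b) + (1 - x) * T (v - b) := by
    by_cases hby : b ≤ y
    · exact hU' (y - b) (v - b) (by omega) (by omega)
    · have h0 : y - b = 0 := by omega
      rw [h0, hT0]
      nlinarith [hTnn (v - b)]
  -- the value at `q = x`
  have hRx : x ≤ x * (x * T (y - b) + (1 - x) * T y) + (1 - x) * (x * T (v - b) + (1 - x) * T v) := by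
    have hmax : T v ≤ T (v - b) := hTanti (Nat.sub_le v b)
    have hmax' : T v ≤ T y := hTanti hyv
    by_cases hyb : y ≤ v - b
    · -- (P2) the pair `(y, v − b)`
      have P2 : x ≤ x * T y + (1 - x) * T (v - b) := hU' y (v - b) hyb (by omega)
      have hA : x * x ≤ x * (x * T (y - b) + (1 - x) * T v) := mul_le_mul_of_nonneg_left P1 hx0
      have hB : (1 - x) * x ≤ (1 - x) * (x * T y + (1 - x) * T (v - b)) := mul_le_mul_of_nonneg_left P2 h1x
      have hdiff : x * (x * T (y - b) + (1 - x) * T y) + (1 - x) * (x * T (v - b) + (1 - x) * T v) -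
          (x * (x * T (y - b) + (1 - x) * T v) + (1 - x) * (x * T y + (1 - x) * T (v - b))) =
          (1 - x) * (2 * x - 1) * (T (v - b) - T v) := by ring
      have hC : 0 ≤ (1 - x) * (2 * x - 1) * (T (v - b) - T v) :=
        mul_nonneg (mul_nonneg h1x (by linarith)) (by linarith)
      nlinarith [hA, hB, hC, hdiff]
    · -- (P2') the pair `(v − b, y)`
      have P2 : x ≤ x * T (v - b) + (1 - x) * T y := by
        by_cases hbv : b ≤ v
        · exact hU' (v - b) y (by omega) (by omega)
        · have h0 : v - b = 0 := by omega
          rw [h0, hT0]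
          nlinarith [hTnn y]
      have hA : x * x ≤ x * (x * T (y - b) + (1 - x) * T v) := mul_le_mul_of_nonneg_left P1 hx0
      have hB : (1 - x) * x ≤ (1 - x) * (x * T (v - b) + (1 - x) * T y) := mul_le_mul_of_nonneg_left P2 h1x
      have hdiff : x * (x * T (y - b) + (1 - x) * T y) + (1 - x) * (x * T (v - b) + (1 - x) * T v) -
          (x * (x * T (y - b) + (1 - x) * T v) + (1 - x) * (x * T (v - b) + (1 - x) * T y)) =
          (1 - x) * (2 * x - 1) * (T y - T v) := by ring
      have hC : 0 ≤ (1 - x) * (2 * x - 1) * (T y - T v) :=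
        mul_nonneg (mul_nonneg h1x (by linarith)) (by linarith)
      nlinarith [hA, hB, hC, hdiff]
  -- the value at `q = 1` is (P3); interpolate (the claim is affine in `q ∈ [x, 1]`)
  have hkey : (1 - x) * (x * (q * T (y - b) + (1 - q) * T y) + (1 - x) * (q * T (v - b) + (1 - q) * T v) - x) =
      (1 - q) * (x * (x * T (y - b) + (1 - x) * T y) + (1 - x) * (x * T (v - b) + (1 - x) * T v) - x) +
      (q - x) * (x * T (y - b) + (1 - x) * T (v - b) - x) := by ring
  have hprod1 : 0 ≤ (1 - q) * (x * (x * T (y - b) + (1 - x) * T y) + (1 - x) * (x * T (v - b) + (1 - x) * T v) - x) :=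
    mul_nonneg (by linarith) (by linarith)
  have hprod2 : 0 ≤ (q - x) * (x * T (y - b) + (1 - x) * T (v - b) - x) := mul_nonneg (by linarith) (by linarith)
  rcases eq_or_lt_of_le (show x ≤ 1 from le_trans hkx hk1) with hx1 | hx1
  · -- `x = 1`: then `q = 1` and the claim is (P3)
    have hq1 : q = 1 := le_antisymm hk1 (hx1 ▸ hkx)
    rw [hq1]
    have := P3
    nlinarith [P3]
  · have hpos : 0 < 1 - x := by linarith
    have h := hkey
    nlinarith [hprod1, hprod2, hkey, hpos]

/-- **Heavy blobs add their sizes to the gap parameter.**  If `S` has the gap property at `E`, `H` is a finset of heavy blobs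
(`x ≤ p k ≤ 1` on `H`) disjoint from `S`, all gates in `[0,1]` and `1/2 ≤ x`, then `S ∪ H` has the gap property at `E + Σ_{k ∈ H} a k`.
[this work] -/
theorem gap_union (p : κ → ℝ) (a : κ → ℕ) (x : ℝ) (hx : 1 / 2 ≤ x) (hp0 : ∀ i, 0 ≤ p i) (hp1 : ∀ i, p i ≤ 1)
    (S : Finset κ) (E : ℕ)
    (hS : ∀ y v : ℕ, y ≤ v → y + v ≤ E + 1 →
      x ≤ x * (∑ s ∈ S.powerset, (∏ i ∈ S, (if i ∈ s then p i else 1 - p i)) *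
              (if y ≤ ∑ i ∈ s, a i then (1 : ℝ) else 0)) +
          (1 - x) * (∑ s ∈ S.powerset, (∏ i ∈ S, (if i ∈ s then p i else 1 - p i)) *
              (if v ≤ ∑ i ∈ s, a i then (1 : ℝ) else 0)))
    (H : Finset κ) (hdisj : Disjoint S H) (hheavy : ∀ k ∈ H, x ≤ p k) :
    ∀ y v : ℕ, y ≤ v → y + v ≤ E + (∑ k ∈ H, a k) + 1 →
      x ≤ x * (∑ s ∈ (S ∪ H).powerset, (∏ i ∈ S ∪ H, (if i ∈ s then p i else 1 - p i)) *
              (if y ≤ ∑ i ∈ s, a i then (1 : ℝ) else 0)) +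
          (1 - x) * (∑ s ∈ (S ∪ H).powerset, (∏ i ∈ S ∪ H, (if i ∈ s then p i else 1 - p i)) *
              (if v ≤ ∑ i ∈ s, a i then (1 : ℝ) else 0)) := by
  induction H using Finset.induction_on with
  | empty =>
    intro y v hyv hsum
    simp only [Finset.union_empty, Finset.sum_empty, add_zero] at hsum ⊢
    exact hS y v hyv hsum
  | @insert k H hkH ih =>
    intro y v hyv hsum
    have hdisj' : Disjoint S H := Finset.disjoint_of_subset_right (Finset.subset_insert k H) hdisj
    have hheavy' : ∀ i ∈ H, x ≤ p i := fun i hi => hheavy i (Finset.mem_insert_of_mem hi)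
    have ih' := ih hdisj' hheavy'
    have hkS : k ∉ S := fun h => Finset.disjoint_left.mp hdisj h (Finset.mem_insert_self k H)
    have hkSH : k ∉ S ∪ H := by
      rw [Finset.mem_union]; exact fun h => h.elim hkS hkH
    have hstep := gap_insert p a x hx (S ∪ H) (fun i _ => hp0 i) (fun i _ => hp1 i) k hkSH
      (hheavy k (Finset.mem_insert_self k H)) (hp1 k) (E + ∑ i ∈ H, a i) ih'
    have hset : S ∪ insert k H = insert k (S ∪ H) := by
      ext i; simp only [Finset.mem_union, Finset.mem_insert]; tauto
    rw [hset]
    refine hstep y v hyv ?_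
    rw [Finset.sum_insert hkH] at hsum
    omega

/-- **The odd size row from the gap calculus** (floor as a parameter): gates `x ≤ p k ≤ 1`, `1/2 ≤ x`, integer sizes with
`2j + 1 ≤ Σ a` ⟹ `x ≤ P(N ≥ j+1)`.  (`gap_union` with `S = ∅`; cf. `tail_ge_gate_of_two_mul_le_size_succ`, whose floor is an attained
gate.) [this work] -/
theorem tail_ge_of_heavy_sizes [Fintype κ] (p : κ → ℝ) (a : κ → ℕ) (x : ℝ) (hx : 1 / 2 ≤ x) (hx1 : x ≤ 1)
    (hpx : ∀ i, x ≤ p i) (hp1 : ∀ i, p i ≤ 1) (j : ℕ) (hsize : 2 * j + 1 ≤ ∑ i, a i) :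
    x ≤ ∑ s : Finset κ, (∏ i, (if i ∈ s then p i else 1 - p i)) * (if j + 1 ≤ ∑ i ∈ s, a i then (1 : ℝ) else 0) := by
  have hx0 : 0 ≤ x := by linarith
  have hp0 : ∀ i, 0 ≤ p i := fun i => le_trans hx0 (hpx i)
  have hS : ∀ y v : ℕ, y ≤ v → y + v ≤ 0 + 1 →
      x ≤ x * (∑ s ∈ (∅ : Finset κ).powerset, (∏ i ∈ (∅ : Finset κ), (if i ∈ s then p i else 1 - p i)) *
              (if y ≤ ∑ i ∈ s, a i then (1 : ℝ) else 0)) +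
          (1 - x) * (∑ s ∈ (∅ : Finset κ).powerset, (∏ i ∈ (∅ : Finset κ), (if i ∈ s then p i else 1 - p i)) *
              (if v ≤ ∑ i ∈ s, a i then (1 : ℝ) else 0)) := by
    intro y v hyv hsum
    have hy : y = 0 := by omega
    subst hy
    rw [tailU_zero p a ∅]
    have hnn := tailU_nonneg p a (∅ : Finset κ) (fun i _ => hp0 i) (fun i _ => hp1 i) v
    nlinarith [mul_nonneg (sub_nonneg.mpr hx1) hnn]
  have h := gap_union p a x hx hp0 hp1 ∅ 0 hS Finset.univ (Finset.disjoint_empty_left _) (fun k _ => hpx k)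
    (j + 1) (j + 1) le_rfl (by simpa using (by omega : j + 1 + (j + 1) ≤ 0 + ∑ k, a k + 1))
  rw [Finset.empty_union, tailU_univ] at h
  linarith

/-! ### 3. The splitting certificate -/

/-- **THE SPLITTING CERTIFICATE.**  Gates in `[0,1]`, floor `1/2 ≤ x`, and a finset `S` of blobs such that every blob OFF `S` is
heavy (`x ≤ p k`).  If `S` alone has the gap property at `2j + 1 − Σ_{k ∉ S} a k` — i.e. for all levels `y ≤ v` with
`y + v + Σ_{k ∉ S} a k ≤ 2j + 2`, `x ≤ x·TL_S(y) + (1 − x)·TL_S(v)` — then `x ≤ P(N ≥ j+1)` for the whole system.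
(`gap_union` with `H = Sᶜ`, then the pair `y = v = j+1`.) [this work] -/
theorem tail_ge_of_gapCert [Fintype κ] (p : κ → ℝ) (a : κ → ℕ) (x : ℝ) (hx : 1 / 2 ≤ x) (hx1 : x ≤ 1)
    (hp0 : ∀ i, 0 ≤ p i) (hp1 : ∀ i, p i ≤ 1) (S : Finset κ) (hheavy : ∀ k, k ∉ S → x ≤ p k) (j : ℕ)
    (hS : ∀ y v : ℕ, y ≤ v → y + v + (∑ k ∈ Sᶜ, a k) ≤ 2 * j + 2 →
      x ≤ x * (∑ s ∈ S.powerset, (∏ i ∈ S, (if i ∈ s then p i else 1 - p i)) *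
              (if y ≤ ∑ i ∈ s, a i then (1 : ℝ) else 0)) +
          (1 - x) * (∑ s ∈ S.powerset, (∏ i ∈ S, (if i ∈ s then p i else 1 - p i)) *
              (if v ≤ ∑ i ∈ s, a i then (1 : ℝ) else 0))) :
    x ≤ ∑ s : Finset κ, (∏ i, (if i ∈ s then p i else 1 - p i)) * (if j + 1 ≤ ∑ i ∈ s, a i then (1 : ℝ) else 0) := by
  set A'' : ℕ := ∑ k ∈ Sᶜ, a k with hA
  set E : ℕ := 2 * j + 1 - A'' with hE
  have hS' : ∀ y v : ℕ, y ≤ v → y + v ≤ E + 1 →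
      x ≤ x * (∑ s ∈ S.powerset, (∏ i ∈ S, (if i ∈ s then p i else 1 - p i)) *
              (if y ≤ ∑ i ∈ s, a i then (1 : ℝ) else 0)) +
          (1 - x) * (∑ s ∈ S.powerset, (∏ i ∈ S, (if i ∈ s then p i else 1 - p i)) *
              (if v ≤ ∑ i ∈ s, a i then (1 : ℝ) else 0)) := by
    intro y v hyv hsum
    by_cases hAj : A'' ≤ 2 * j + 1
    · exact hS y v hyv (by omega)
    · have hy : y = 0 := by omega
      subst hy
      rw [tailU_zero p a S]
      have hnn := tailU_nonneg p a S (fun i _ => hp0 i) (fun i _ => hp1 i) v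
      nlinarith [mul_nonneg (sub_nonneg.mpr hx1) hnn]
  have h := gap_union p a x hx hp0 hp1 S E hS' Sᶜ disjoint_compl_right (fun k hk => hheavy k (Finset.mem_compl.mp hk))
    (j + 1) (j + 1) le_rfl (by omega)
  rw [Finset.union_compl, tailU_univ] at h
  linarith

end IndepBlob

end Quant

end Summit.CriticalPhenomena.PercolationContinuityZ3.Theorems
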